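import Summits.QuantumFields.BalabanUV.T4Continuum.Support.NE7PairwiseFibre

/-!
# NE7PairwiseFibreSplit — row NE7 (node U5), route «PAIR-CAUCHY» (R-P2, 1-bis): the good clause on FULL fibres
# SPLITS as «(5) = (5a) ⊕ (5b)» — road P1's good clause on the sub-fibre SMOOTH above the coarser cutoff (5a, NODE O's
# small-field transport) plus a ONE-RUN CONDITIONAL fine-age large-field suppression (5b), absorbed by re-centring

Cell `pub-balaban`, rung (B)+1 sub-cell t4, lineage `b2b-balaban-t4-ne7-p2` (CRUX PROVER NE7 #2 under the
coordinator ruling «YM redirect», 2026-08-21; generation 56; texts: `HOME/t4/b2b-balaban-t4-ne7-p2/g56/ROUTE2-NE7-P2.md`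
v1.11 §14, the crux refuter's `HOME/b2b-balaban-t4-ne7-refuter/PRICING-NE7.md` v11.1 §63 (b) — its ONE LOCATED
PRECISION «(5) = (5a) ⊕ (5b)»: «the good clause compares `A K t τ` with the FULL fibre pointwise per good coarse label;
that fibre carries the finer run's large fields at the FORGOTTEN ages (K, K′]; the lower half is NODE O's transport alone,
the UPPER half needs in addition a ONE-RUN CONDITIONAL (per-fibre) fine-age suppression `Σ_{τ′↦τ, rough above K} A′ ≤
ρ_K·Σ_{τ′↦τ, smooth above K} A′`, ρ_K null UV-uniformly (input (3) in CONDITIONAL form — not implied by the aggregate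
(3); road P1 faces it for ONE age in `HybridSandwich.of_fibers`' `hu`); then `c ↦ c + ½log(1+ρ_K)` absorbs it» — and
the headers of `Support/NE7PairwiseFibre` (p261562), `Support/NE7PairwiseOffsetEndSeq` (p261256),
`Support/NE7PairwiseDeepBadClass` (p259975), `Balaban1983to89/T4HybridMatching` §3 (`fiberSum`).  HONEST FRAMING
(page 1): FIXED FINITE T⁴, rung (B)+1 = existence AND uniqueness of the `ε = L^{−K} → 0` limit of unit-scale averaged
expectations, CONDITIONAL on BetaPertH and the nine spine estimates (0/9 proved); NOT infinite volume, NOT a mass gap,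
NOT the Clay problem.  NE7 is NOT PRINTED in [Balaban1984PropagatorsI]–[Balaban1989LargeFieldII] and NOT proved here.
Everything below is [folklore] finite-sum and `exp ∕ log` bookkeeping over HYPOTHESIS SHAPES (abstract finite families
of reals); no definition, no cite tag, nothing printed asserted, no `sorry`.

WHY.  After p261256 + p261562 the (E♭) socket's only two-run input is (5): per window `w` and finer-run sequence `ν`,
road P1's `GoodClause` for `(A K, fibre sum of A (K + ν K))`, a sandwich `e^{c − vol·δ} A K t τ ≤ Σ_{π τ′ = τ} A K′ t τ′
≤ e^{c + vol·δ} A K t τ` per good coarse label `τ`.  The FIBRE `{τ′ : π τ′ = τ}` contains ALL run-`K′` labels extending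
`τ`, also those with a large-field ∕ boundary degree of freedom at a FORGOTTEN age `j ∈ (K, K′]` (`π` remembers the ages
`≤ K` only; `Bad w K t` cannot see them).  NODE O (the small-field background transport) supplies the sandwich for the
SUB-fibre SMOOTH above `K` (5a); the rest of the fibre is the finer run's own fine-age large-field weight SITTING ON a
good coarse label, controlled by a ONE-RUN statement about run `K′` alone, CONDITIONAL on the coarse label:
`Σ_{fibre, rough above K} A′ ≤ ρ·Σ_{fibre, smooth above K} A′`, `ρ = ρ w K → 0` UNIFORMLY in `K′ ≥ K` (5b).  Then the full
fibre lies in `[e^{c − vol·δ} A, (1 + ρ)·e^{c + vol·δ} A]`; RE-CENTRING at `c + ½log(1 + ρ)` gives (5) with remainder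
`δ + log(1 + ρ)∕(2·vol)`, null when `δ` and `ρ` are.  This file proves that, assembles it with p261562 and with p259975's
level pieces (rough above `K` := `⋃_{j ∈ (K, K′]} LF K′ j t`), exits at node U6 ∕ U0 by name, and records the CONTRAST
that (5b) is NOT implied by the aggregate one-run bound (3).

WHAT IS PROVED ([folklore]).
§1 **`fiberSum_split`** (`fiberSum S = fiberSum (S \ R) + fiberSum R`, `R ⊆ S`), `fiberSum_sdiff_le`, the relative ↔
   conditional conversion `le_mul_of_le_frac` ∕ **`fiberSum_cond_of_relative`** (`rough ≤ ϱ·full`, `ϱ < 1` ⟹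
   `rough ≤ (ϱ∕(1−ϱ))·smooth`: the printed relative form feeds (5b)).
§2 **`goodClause_of_sandwich`** — the RE-CENTRING LEMMA at `GoodClause` level: a good clause for `(A, B₁)` with
   remainder `δ` and `B₁ ≤ B₂ ≤ (1 + ρ K)·B₁` on the good class (`0 ≤ ρ`, `0 < vol`) ⟹ the good clause for `(A, B₂)`
   with remainder `δ K + log(1 + ρ K)∕(2·vol)`; **`tendsto_splitRemainder`** (null when `δ → 0` and `ρ → 0`).
§3 **`goodClause_fullFibre`** — (5a) ⊕ (5b) ⟹ (5): the good clause for `(A, fibre sums over S K \ R K t)` plus the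
   conditional suppression `fiberSum (R K t) ≤ ρ K · fiberSum (S K \ R K t)` per good coarse label ⟹ the good clause
   for `(A, fibre sums over S K)`.
§4 **`pairCauchy_of_smoothFibreClauses`** — p261562's `pairCauchy_of_oneRunBadClasses` with its `hgood` (5) REPLACED by
   (5a) per-sequence good clauses on the smooth-above-`K` sub-fibres + (5b) the one-run conditional suppression with
   `ρ w K → 0`, `0 ≤ ρ`, uniform in the finer run; same `ε–K₀` pair-Cauchy conclusion.
§5 **`pairCauchy_of_levelPieces_split`** — the level-pieces form: rough above `K` in run `K′` := `⋃_{j ∈ (K, K′]} LF K′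
   j t`; per-level one-run weights `p j` (summable, `Σ' p < 1`), compatibility, (5a), (5b) ⟹ pair-Cauchy.
§6 EXITS BY NAME: **`genFunCauchy_of_levelPieces_split`** (node U6 `T4Assembly.GenFunCauchy S l₀`),
   `hasContinuumLimit_of_levelPieces_split` (node U0).
§7 CONTRAST **`condSuppression_not_of_aggregate`**: for every `ε > 0` a finite family whose aggregate rough fraction is
   `≤ ε` while one fibre is exactly half rough (conditional ratio 1) — (5b) is a genuinely CONDITIONAL ask.

NOT DELIVERED: (5a) for Bałaban's runs (road P1's END on the smooth sub-fibre per offset sequence = NODE O's small-field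
transport — (E♭-inst) (i), two-run, supplier ask), (5b) for Bałaban's runs (rows NE7b ∕ NE7c's printed TYPE (1.62) in
conditional form, ONE-RUN, NOT instantiated), the level pieces and their compatibility (design).  NOT NE7 (spine 0/9),
NOT summit progress.  HONEST DEPENDENCY: continuum YM on T⁴ ⇐ BetaPertH ∧ nine spine estimates (0/9 proved); BetaPertH
⇐ (D1) ∧ (D4) ∧ CAP+tail; G-an2-4 gates asym, D1 and NE2/3/4.
-/

noncomputable section

open Finset Filter Topology
open scoped BigOperators

namespace Summit.QuantumFields.BalabanUV.T4Continuum.NE7PairwiseFibreSplit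

open Literature.MathematicalPhysics.QuantumFieldTheory
open Literature.MathematicalPhysics.QuantumFieldTheory.Balaban1983to89
open T4HybridMatching (fiberSum sum_fiberSum fiberSum_nonneg)
open T4GoodClassBudget (GoodClause)
open Summit.QuantumFields.BalabanUV.T4Continuum.NE7PairwiseCauchyWindow (cauchySeq_genFun_of_pairCauchy)
open Summit.QuantumFields.BalabanUV.T4Continuum.NE7PairwiseFibre
  (pairCauchy_of_oneRunBadClasses compat_biUnion tsum_tail_le_tsum)
open Summit.QuantumFields.BalabanUV.T4Continuum.NE7PairwiseDeepBadClass
  (levelUnion_weight_le_tail tendsto_tsum_tail)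

/-! ## §1 Splitting a fibre along a finer set, and the relative ∕ conditional forms of a suppression -/

section Split

variable {σ ι : Type*} [DecidableEq ι] [DecidableEq σ]

/-- **THE FIBRE SPLITS**: for `R ⊆ S`, the fibre sum over `S` is the fibre sum over `S \ R` (the «smooth» part) plus the
fibre sum over `R` (the «rough» part), fibre by fibre. [folklore] -/
theorem fiberSum_split {S R : Finset σ} (hR : R ⊆ S) (π : σ → ι) (b : σ → ℝ) (τ : ι) :
    fiberSum S π b τ = fiberSum (S \ R) π b τ + fiberSum R π b τ := by
  unfold fiberSum
  rw [← Finset.sum_union (Finset.disjoint_filter_filter Finset.sdiff_disjoint), ← Finset.filter_union,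
    Finset.sdiff_union_of_subset hR]

/-- The smooth part of a fibre of nonnegative weights is at most the full fibre. [folklore] -/
theorem fiberSum_sdiff_le {S R : Finset σ} (hR : R ⊆ S) {π : σ → ι} {b : σ → ℝ} (hb : ∀ s ∈ S, 0 ≤ b s) (τ : ι) :
    fiberSum (S \ R) π b τ ≤ fiberSum S π b τ := by
  rw [fiberSum_split hR]
  exact le_add_of_nonneg_right (fiberSum_nonneg (fun s hs => hb s (hR hs)) τ)

/-- RELATIVE ⟹ CONDITIONAL, scalar form: `r ≤ ϱ·(s + r)` with `ϱ < 1` gives `r ≤ (ϱ∕(1−ϱ))·s`. [folklore] -/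
theorem le_mul_of_le_frac {r s ϱ : ℝ} (hϱ1 : ϱ < 1) (h : r ≤ ϱ * (s + r)) : r ≤ ϱ / (1 - ϱ) * s := by
  have h1 : 0 < 1 - ϱ := sub_pos.mpr hϱ1
  rw [div_mul_eq_mul_div, le_div_iff₀ h1]
  have : r * (1 - ϱ) = r - ϱ * r := by ring
  rw [this]
  linarith

/-- **RELATIVE ⟹ CONDITIONAL on a fibre**: if the rough part of a fibre weighs at most `ϱ < 1` times the FULL fibre (the
printed large-field bounds' native relative form, read per coarse label), then it weighs at most `ϱ∕(1−ϱ)` times the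
SMOOTH part — the form (5b) of §3–§5. [folklore] -/
theorem fiberSum_cond_of_relative {S R : Finset σ} (hR : R ⊆ S) {π : σ → ι} {b : σ → ℝ} {τ : ι} {ϱ : ℝ}
    (hϱ1 : ϱ < 1) (h : fiberSum R π b τ ≤ ϱ * fiberSum S π b τ) :
    fiberSum R π b τ ≤ ϱ / (1 - ϱ) * fiberSum (S \ R) π b τ := by
  rw [fiberSum_split hR] at h
  exact le_mul_of_le_frac hϱ1 h

end Split

/-! ## §2 Re-centring at `GoodClause` level -/

section Recentre

variable {ι : Type*} [DecidableEq ι] {l₀ vol : ℝ} {T : ℕ → Finset ι} {A B₁ B₂ : ℕ → ℝ → ι → ℝ}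
  {Bad : ℕ → ℝ → Finset ι} {δ ρ : ℕ → ℝ}

/-- **THE RE-CENTRING LEMMA.**  A good clause for `(A, B₁)` with remainder `δ` (constant `c` per cutoff), and on the good
class `B₁ ≤ B₂ ≤ (1 + ρ K)·B₁` with `0 ≤ ρ`, `0 < vol` ⟹ the good clause for `(A, B₂)` with constant `c + ½log(1 + ρ K)`
and remainder `δ K + log(1 + ρ K)∕(2·vol)` (the window `[c − vol·δ, c + vol·δ + log(1+ρ)]` re-centred). [folklore] -/
theorem goodClause_of_sandwich (hvol : 0 < vol) (hρ : ∀ K, 0 ≤ ρ K) (h : GoodClause l₀ vol T A B₁ Bad δ)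
    (h12 : ∀ K t, |t| ≤ l₀ → ∀ τ ∈ T K \ Bad K t, B₁ K t τ ≤ B₂ K t τ ∧ B₂ K t τ ≤ (1 + ρ K) * B₁ K t τ) :
    GoodClause l₀ vol T A B₂ Bad (fun K => δ K + Real.log (1 + ρ K) / (2 * vol)) := by
  intro K
  obtain ⟨c, hc⟩ := h K
  refine ⟨c + Real.log (1 + ρ K) / 2, fun t ht τ hτ => ?_⟩
  obtain ⟨hlo, hhi⟩ := hc t ht τ hτ
  obtain ⟨h1, h2⟩ := h12 K t ht τ hτ
  have hvne : vol ≠ 0 := hvol.ne'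
  have e1 : c + Real.log (1 + ρ K) / 2 - vol * (δ K + Real.log (1 + ρ K) / (2 * vol)) = c - vol * δ K := by
    field_simp
    ring
  have e2 : c + Real.log (1 + ρ K) / 2 + vol * (δ K + Real.log (1 + ρ K) / (2 * vol)) =
      Real.log (1 + ρ K) + (c + vol * δ K) := by
    field_simp
    ring
  have hρ1 : 0 < 1 + ρ K := by linarith [hρ K]
  constructor
  · rw [e1]
    exact hlo.trans h1
  · rw [e2, Real.exp_add, Real.exp_log hρ1, mul_assoc]
    exact h2.trans (mul_le_mul_of_nonneg_left hhi hρ1.le)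

/-- THE SPLIT REMAINDER IS NULL when the good-clause remainder and the conditional suppression are:
`δ → 0 ∧ ρ → 0 ⟹ δ K + log(1 + ρ K)∕(2·vol) → 0`. [folklore] -/
theorem tendsto_splitRemainder (vol : ℝ) (hδ : Tendsto δ atTop (𝓝 0)) (hρ : Tendsto ρ atTop (𝓝 0)) :
    Tendsto (fun K => δ K + Real.log (1 + ρ K) / (2 * vol)) atTop (𝓝 0) := by
  have h1 : Tendsto (fun K => 1 + ρ K) atTop (𝓝 1) := by simpa using tendsto_const_nhds.add hρ
  have h2 : Tendsto (fun K => Real.log (1 + ρ K)) atTop (𝓝 0) := by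
    simpa [Real.log_one] using h1.log one_ne_zero
  simpa using hδ.add (h2.div_const (2 * vol))

end Recentre

/-! ## §3 The fibre instance: (5a) ⊕ (5b) ⟹ (5) -/

section FullFibre

variable {σ ι : Type*} [DecidableEq ι] [DecidableEq σ] {l₀ vol : ℝ} {T : ℕ → Finset ι} {A : ℕ → ℝ → ι → ℝ}
  {Bad : ℕ → ℝ → Finset ι}

/-- **(5) = (5a) ⊕ (5b).**  Finer label sets `S K` with a «rough above the coarse cutoff» subset `R K t ⊆ S K`, class maps
`p K : σ → ι`, nonnegative finer weights `b K t`; (5a) road P1's good clause for `(A, fibre sums over the SMOOTH part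
S K \ R K t)` with remainder `δ`; (5b) the ONE-RUN CONDITIONAL suppression `fiberSum (R K t) ≤ ρ K · fiberSum (S K \
R K t)` per GOOD coarse label, `0 ≤ ρ` ⟹ the good clause for `(A, fibre sums over the FULL S K)` — the (E♭) socket's
`hgood` — with remainder `δ K + log(1 + ρ K)∕(2·vol)`. [folklore] -/
theorem goodClause_fullFibre {S : ℕ → Finset σ} {R : ℕ → ℝ → Finset σ} {p : ℕ → σ → ι} {b : ℕ → ℝ → σ → ℝ}
    {δ ρ : ℕ → ℝ} (hvol : 0 < vol) (hρ : ∀ K, 0 ≤ ρ K) (hR : ∀ K t, |t| ≤ l₀ → R K t ⊆ S K)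
    (hb : ∀ K t, |t| ≤ l₀ → ∀ s ∈ S K, 0 ≤ b K t s)
    (hgood : GoodClause l₀ vol T A (fun K t => fiberSum (S K \ R K t) (p K) (b K t)) Bad δ)
    (hcond : ∀ K t, |t| ≤ l₀ → ∀ τ ∈ T K \ Bad K t,
      fiberSum (R K t) (p K) (b K t) τ ≤ ρ K * fiberSum (S K \ R K t) (p K) (b K t) τ) :
    GoodClause l₀ vol T A (fun K t => fiberSum (S K) (p K) (b K t)) Bad
      (fun K => δ K + Real.log (1 + ρ K) / (2 * vol)) := by
  refine goodClause_of_sandwich hvol hρ hgood fun K t ht τ hτ => ?_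
  show fiberSum (S K \ R K t) (p K) (b K t) τ ≤ fiberSum (S K) (p K) (b K t) τ ∧
    fiberSum (S K) (p K) (b K t) τ ≤ (1 + ρ K) * fiberSum (S K \ R K t) (p K) (b K t) τ
  refine ⟨fiberSum_sdiff_le (hR K t ht) (hb K t ht) τ, ?_⟩
  rw [fiberSum_split (hR K t ht), add_mul, one_mul]
  exact add_le_add le_rfl (hcond K t ht τ hτ)

end FullFibre

/-! ## §4 The socket with (5) replaced by (5a) ⊕ (5b) -/

section Socket

variable {ι : Type*} [DecidableEq ι] {l₀ vol : ℝ} {T : ℕ → Finset ι} {A : ℕ → ℝ → ι → ℝ} {Z : ℕ → ℝ → ℝ}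

/-- **PAIR-CAUCHY FROM (5a) ⊕ (5b) AND ONE-RUN BAD-CLASS DATA.**  `NE7PairwiseFibre.pairCauchy_of_oneRunBadClasses`
(one family of runs, projections `π K K′`, K-only windowed bad classes with one-run bounds `η w`, compatibility, `η w < 1`,
`η → 0`) with its only two-run input — the good clause on FULL fibres — REPLACED by: finer sets `Rgh K K′ t ⊆ T K′` («rough
above K»: run-`K′` labels with a large field at a forgotten age in (K, K′]); (5a) per window `w` and offset sequence `ν`,
road P1's good clause for `(A K, fibre sum of A (K + ν K) over T (K + ν K) \ Rgh)`, null remainder `δ w ν` (NODE O's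
small-field transport); (5b) for all `K ≤ K′`, per GOOD coarse label, `fiberSum Rgh ≤ ρ w K · fiberSum (T K′ \ Rgh)`,
`0 ≤ ρ`, `ρ w → 0` — ONE-RUN, conditional, UNIFORM in the finer run; `0 < vol`.  THEN pair-Cauchy. [folklore] -/
theorem pairCauchy_of_smoothFibreClauses (π : ℕ → ℕ → ι → ι) {Bad : ℕ → ℕ → ℝ → Finset ι}
    {Rgh : ℕ → ℕ → ℝ → Finset ι} {δ : ℕ → (ℕ → ℕ) → ℕ → ℝ} {η : ℕ → ℝ} {ρ : ℕ → ℕ → ℝ} (hvol : 0 < vol)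
    (hZA : ∀ (K : ℕ) (t : ℝ), |t| ≤ l₀ → Z K t = ∑ τ ∈ T K, A K t τ)
    (hpos : ∀ (K : ℕ) (t : ℝ), |t| ≤ l₀ → 0 < ∑ τ ∈ T K, A K t τ)
    (hA : ∀ K t, |t| ≤ l₀ → ∀ τ ∈ T K, 0 ≤ A K t τ)
    (hmaps : ∀ K K', K ≤ K' → ∀ τ' ∈ T K', π K K' τ' ∈ T K)
    (hbad : ∀ w K t, |t| ≤ l₀ → Bad w K t ⊆ T K)
    (hcompat : ∀ w K K' t, K ≤ K' → |t| ≤ l₀ → ∀ τ' ∈ T K', π K K' τ' ∈ Bad w K t → τ' ∈ Bad w K' t)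
    (hWone : ∀ w K t, |t| ≤ l₀ → ∑ τ ∈ Bad w K t, A K t τ ≤ η w * ∑ τ ∈ T K, A K t τ)
    (hη1 : ∀ w, η w < 1) (hη : Tendsto η atTop (𝓝 0))
    (hR : ∀ K K' t, K ≤ K' → |t| ≤ l₀ → Rgh K K' t ⊆ T K')
    (hgoodS : ∀ w (ν : ℕ → ℕ), GoodClause l₀ vol T A
      (fun K t => fiberSum (T (K + ν K) \ Rgh K (K + ν K) t) (π K (K + ν K)) (A (K + ν K) t)) (Bad w) (δ w ν))
    (hδ : ∀ w ν, Tendsto (δ w ν) atTop (𝓝 0))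
    (hcond : ∀ w K K' t, K ≤ K' → |t| ≤ l₀ → ∀ τ ∈ T K \ Bad w K t,
      fiberSum (Rgh K K' t) (π K K') (A K' t) τ ≤ ρ w K * fiberSum (T K' \ Rgh K K' t) (π K K') (A K' t) τ)
    (hρ0 : ∀ w K, 0 ≤ ρ w K) (hρ : ∀ w, Tendsto (ρ w) atTop (𝓝 0)) :
    ∀ ε : ℝ, 0 < ε → ∃ K₀ : ℕ, ∀ K K' : ℕ, K₀ ≤ K → K ≤ K' →
      ∃ c : ℝ, ∀ t : ℝ, |t| ≤ l₀ → |Real.log (Z K' t) - Real.log (Z K t) - c| ≤ ε :=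
  pairCauchy_of_oneRunBadClasses π (δ := fun w ν K => δ w ν K + Real.log (1 + ρ w K) / (2 * vol))
    hZA hpos hA hmaps hbad hcompat hWone hη1 hη
    (fun w ν => goodClause_fullFibre hvol (hρ0 w)
      (fun K t ht => hR K (K + ν K) t (Nat.le_add_right K (ν K)) ht)
      (fun K t ht s hs => hA (K + ν K) t ht s hs) (hgoodS w ν)
      (fun K t ht τ hτ => hcond w K (K + ν K) t (Nat.le_add_right K (ν K)) ht τ hτ))
    (fun w ν => tendsto_splitRemainder vol (hδ w ν) (hρ w))

end Socket

/-! ## §5 The level-pieces form: rough above `K` := the finer run's level pieces at the forgotten ages `(K, K′]` -/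

section LevelPieces

variable {ι : Type*} [DecidableEq ι] {l₀ vol : ℝ} {T : ℕ → Finset ι} {A : ℕ → ℝ → ι → ℝ} {Z : ℕ → ℝ → ℝ}

/-- The finer run's level pieces at the forgotten ages sit inside its labels. [folklore] -/
theorem biUnion_Ioc_subset {LF : ℕ → ℕ → ℝ → Finset ι} {K K' : ℕ} {t : ℝ}
    (hLF : ∀ j, LF K' j t ⊆ T K') : (Finset.Ioc K K').biUnion (fun j => LF K' j t) ⊆ T K' :=
  Finset.biUnion_subset.mpr fun j _ => hLF j

/-- **PAIR-CAUCHY FROM PER-LEVEL ONE-RUN PIECES, WITH THE GOOD CLAUSE SPLIT.**  `NE7PairwiseFibre.pairCauchy_of_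
levelPieces` (per-level pieces `LF K j t ⊆ T K` with one-run weights `≤ p j·total`, `0 ≤ p` summable, `Σ' p < 1`, the SAME
`p` for every run; compatibility; bad class := the level union over `j ∈ [w, K]`) with its good clause on full fibres
REPLACED by: (5a) road P1's good clause, per window and offset sequence, for `(A K, fibre sum of A K′ over the run-K′
labels with NO large-field piece at the ages (K, K′])`, null remainder; (5b) per good coarse label and all `K ≤ K′`, the
fibre weight of `⋃_{j ∈ (K, K′]} LF K′ j t` is `≤ ρ w K ·` that of its complement, `0 ≤ ρ`, `ρ w → 0`; `0 < vol`. [folklore] -/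
theorem pairCauchy_of_levelPieces_split (π : ℕ → ℕ → ι → ι) {LF : ℕ → ℕ → ℝ → Finset ι} {p : ℕ → ℝ}
    {δ : ℕ → (ℕ → ℕ) → ℕ → ℝ} {ρ : ℕ → ℕ → ℝ} (hvol : 0 < vol)
    (hZA : ∀ (K : ℕ) (t : ℝ), |t| ≤ l₀ → Z K t = ∑ τ ∈ T K, A K t τ)
    (hpos : ∀ (K : ℕ) (t : ℝ), |t| ≤ l₀ → 0 < ∑ τ ∈ T K, A K t τ)
    (hA0 : ∀ K t, |t| ≤ l₀ → ∀ τ, 0 ≤ A K t τ)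
    (hmaps : ∀ K K', K ≤ K' → ∀ τ' ∈ T K', π K K' τ' ∈ T K)
    (hLF : ∀ K j t, |t| ≤ l₀ → LF K j t ⊆ T K)
    (hcompat : ∀ K K' t, K ≤ K' → |t| ≤ l₀ → ∀ j, j ≤ K → ∀ τ', π K K' τ' ∈ LF K j t → τ' ∈ LF K' j t)
    (hp0 : ∀ j, 0 ≤ p j) (hp : Summable p) (hp1 : ∑' j, p j < 1)
    (hpLF : ∀ K j t, |t| ≤ l₀ → ∑ τ ∈ LF K j t, A K t τ ≤ p j * ∑ τ ∈ T K, A K t τ)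
    (hgoodS : ∀ w (ν : ℕ → ℕ), GoodClause l₀ vol T A
      (fun K t => fiberSum (T (K + ν K) \ (Finset.Ioc K (K + ν K)).biUnion (fun j => LF (K + ν K) j t))
        (π K (K + ν K)) (A (K + ν K) t))
      (fun K t => (Finset.Icc w K).biUnion (fun j => LF K j t)) (δ w ν))
    (hδ : ∀ w ν, Tendsto (δ w ν) atTop (𝓝 0))
    (hcond : ∀ w K K' t, K ≤ K' → |t| ≤ l₀ → ∀ τ ∈ T K \ (Finset.Icc w K).biUnion (fun j => LF K j t),
      fiberSum ((Finset.Ioc K K').biUnion (fun j => LF K' j t)) (π K K') (A K' t) τ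
        ≤ ρ w K * fiberSum (T K' \ (Finset.Ioc K K').biUnion (fun j => LF K' j t)) (π K K') (A K' t) τ)
    (hρ0 : ∀ w K, 0 ≤ ρ w K) (hρ : ∀ w, Tendsto (ρ w) atTop (𝓝 0)) :
    ∀ ε : ℝ, 0 < ε → ∃ K₀ : ℕ, ∀ K K' : ℕ, K₀ ≤ K → K ≤ K' →
      ∃ c : ℝ, ∀ t : ℝ, |t| ≤ l₀ → |Real.log (Z K' t) - Real.log (Z K t) - c| ≤ ε := by
  refine pairCauchy_of_smoothFibreClauses π (Bad := fun w K t => (Finset.Icc w K).biUnion (fun j => LF K j t))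
    (Rgh := fun K K' t => (Finset.Ioc K K').biUnion (fun j => LF K' j t))
    (η := fun w => ∑' j, p (j + w)) hvol hZA hpos (fun K t ht τ _ => hA0 K t ht τ) hmaps ?_ ?_ ?_ ?_
    tendsto_tsum_tail ?_ hgoodS hδ hcond hρ0 hρ
  · exact fun w K t ht => Finset.biUnion_subset.mpr fun j _ => hLF K j t ht  -- the level union sits inside the labels
  · exact fun w K K' t hKK' ht τ' _ h => compat_biUnion hKK' (hcompat K K' t hKK' ht) w τ' h  -- compatibility
  · -- the one-run bound: a level tail, uniformly in K
    exact fun w K t ht => levelUnion_weight_le_tail (fun j => LF K j t) (hA0 K t ht) hp0 hp (hpos K t ht).le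
      (fun j => hpLF K j t ht) w K
  · exact fun w => lt_of_le_of_lt (tsum_tail_le_tsum hp0 hp w) hp1  -- η w < 1
  · exact fun K K' t _ ht => biUnion_Ioc_subset fun j => hLF K' j t ht  -- forgotten-age pieces ⊆ finer labels

end LevelPieces

/-! ## §6 Exits by name: node U6 and node U0 -/

section Exit

open Missing T4Continuum T4Assembly

variable {G : Type*} [GaugeGroup G] [MeasurableSpace G] [HaarData G] {O : Type*}

/-- **NODE U6 FROM PER-LEVEL ONE-RUN PIECES + (5a) ⊕ (5b).**  Per string `os`: ONE family of runs on labels `T K` with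
nonnegative terms and positive partition functions (`0 < vol`), label projections, per-level large-field pieces with
one-run weights `≤ p j·total` (`0 ≤ p` summable, `Σ' p < 1`) compatible under projection, (5a) road P1's good clause for
`(A K, fibre sum of A (K + ν K) over the labels SMOOTH above K)` at every window and along every offset sequence with a
null remainder, and (5b) the one-run conditional suppression of the forgotten-age pieces per good coarse label with a
null `ρ w` ⟹ `GenFunCauchy S l₀`. [folklore] -/
theorem genFunCauchy_of_levelPieces_split {ι : Type*} [DecidableEq ι] (S : TorusScheme G O) {l₀ : ℝ} (hl₀ : 0 ≤ l₀)
    (h : ∀ os : List O, ∃ (vol : ℝ) (T : ℕ → Finset ι) (A : ℕ → ℝ → ι → ℝ) (π : ℕ → ℕ → ι → ι)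
      (LF : ℕ → ℕ → ℝ → Finset ι) (p : ℕ → ℝ) (δ : ℕ → (ℕ → ℕ) → ℕ → ℝ) (ρ : ℕ → ℕ → ℝ),
      0 < vol ∧
      (∀ (K : ℕ) (t : ℝ), |t| ≤ l₀ → T4GenFunBounds.schemeZ S os K t = ∑ τ ∈ T K, A K t τ) ∧
      (∀ (K : ℕ) (t : ℝ), |t| ≤ l₀ → 0 < ∑ τ ∈ T K, A K t τ) ∧
      (∀ K t, |t| ≤ l₀ → ∀ τ, 0 ≤ A K t τ) ∧
      (∀ K K', K ≤ K' → ∀ τ' ∈ T K', π K K' τ' ∈ T K) ∧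
      (∀ K j t, |t| ≤ l₀ → LF K j t ⊆ T K) ∧
      (∀ K K' t, K ≤ K' → |t| ≤ l₀ → ∀ j, j ≤ K → ∀ τ', π K K' τ' ∈ LF K j t → τ' ∈ LF K' j t) ∧
      (∀ j, 0 ≤ p j) ∧ Summable p ∧ ∑' j, p j < 1 ∧
      (∀ K j t, |t| ≤ l₀ → ∑ τ ∈ LF K j t, A K t τ ≤ p j * ∑ τ ∈ T K, A K t τ) ∧
      (∀ w (ν : ℕ → ℕ), GoodClause l₀ vol T A
        (fun K t => fiberSum (T (K + ν K) \ (Finset.Ioc K (K + ν K)).biUnion (fun j => LF (K + ν K) j t))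
          (π K (K + ν K)) (A (K + ν K) t))
        (fun K t => (Finset.Icc w K).biUnion (fun j => LF K j t)) (δ w ν)) ∧
      (∀ w ν, Tendsto (δ w ν) atTop (𝓝 0)) ∧
      (∀ w K K' t, K ≤ K' → |t| ≤ l₀ → ∀ τ ∈ T K \ (Finset.Icc w K).biUnion (fun j => LF K j t),
        fiberSum ((Finset.Ioc K K').biUnion (fun j => LF K' j t)) (π K K') (A K' t) τ
          ≤ ρ w K * fiberSum (T K' \ (Finset.Ioc K K').biUnion (fun j => LF K' j t)) (π K K') (A K' t) τ) ∧
      (∀ w K, 0 ≤ ρ w K) ∧ (∀ w, Tendsto (ρ w) atTop (𝓝 0))) :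
    GenFunCauchy S l₀ := by
  intro os t ht
  obtain ⟨vol, T, A, π, LF, p, δ, ρ, hvol, hZA, hpos, hA0, hmaps, hLF, hcompat, hp0, hp, hp1, hpLF, hgoodS, hδ,
    hcond, hρ0, hρ⟩ := h os
  exact cauchySeq_genFun_of_pairCauchy hl₀
    (pairCauchy_of_levelPieces_split π hvol hZA hpos hA0 hmaps hLF hcompat hp0 hp hp1 hpLF hgoodS hδ hcond hρ0 hρ)
    ht

/-- … and NODE U0 (`Missing.HasContinuumLimit S`) by `T4Assembly.hasContinuumLimit_of_genFunCauchy`. [folklore] -/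
theorem hasContinuumLimit_of_levelPieces_split [RegularGaugeGroup G] {ι : Type*} [DecidableEq ι]
    (S : TorusScheme G O) (hβ : ∀ K, 0 ≤ S.β K) (hm : ∀ K o, Measurable (S.obs K o))
    (h1 : ∀ K o U, |S.obs K o U| ≤ 1) {l₀ : ℝ} (hl₀ : 0 < l₀)
    (h : ∀ os : List O, ∃ (vol : ℝ) (T : ℕ → Finset ι) (A : ℕ → ℝ → ι → ℝ) (π : ℕ → ℕ → ι → ι)
      (LF : ℕ → ℕ → ℝ → Finset ι) (p : ℕ → ℝ) (δ : ℕ → (ℕ → ℕ) → ℕ → ℝ) (ρ : ℕ → ℕ → ℝ),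
      0 < vol ∧
      (∀ (K : ℕ) (t : ℝ), |t| ≤ l₀ → T4GenFunBounds.schemeZ S os K t = ∑ τ ∈ T K, A K t τ) ∧
      (∀ (K : ℕ) (t : ℝ), |t| ≤ l₀ → 0 < ∑ τ ∈ T K, A K t τ) ∧
      (∀ K t, |t| ≤ l₀ → ∀ τ, 0 ≤ A K t τ) ∧
      (∀ K K', K ≤ K' → ∀ τ' ∈ T K', π K K' τ' ∈ T K) ∧
      (∀ K j t, |t| ≤ l₀ → LF K j t ⊆ T K) ∧
      (∀ K K' t, K ≤ K' → |t| ≤ l₀ → ∀ j, j ≤ K → ∀ τ', π K K' τ' ∈ LF K j t → τ' ∈ LF K' j t) ∧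
      (∀ j, 0 ≤ p j) ∧ Summable p ∧ ∑' j, p j < 1 ∧
      (∀ K j t, |t| ≤ l₀ → ∑ τ ∈ LF K j t, A K t τ ≤ p j * ∑ τ ∈ T K, A K t τ) ∧
      (∀ w (ν : ℕ → ℕ), GoodClause l₀ vol T A
        (fun K t => fiberSum (T (K + ν K) \ (Finset.Ioc K (K + ν K)).biUnion (fun j => LF (K + ν K) j t))
          (π K (K + ν K)) (A (K + ν K) t))
        (fun K t => (Finset.Icc w K).biUnion (fun j => LF K j t)) (δ w ν)) ∧
      (∀ w ν, Tendsto (δ w ν) atTop (𝓝 0)) ∧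
      (∀ w K K' t, K ≤ K' → |t| ≤ l₀ → ∀ τ ∈ T K \ (Finset.Icc w K).biUnion (fun j => LF K j t),
        fiberSum ((Finset.Ioc K K').biUnion (fun j => LF K' j t)) (π K K') (A K' t) τ
          ≤ ρ w K * fiberSum (T K' \ (Finset.Ioc K K').biUnion (fun j => LF K' j t)) (π K K') (A K' t) τ) ∧
      (∀ w K, 0 ≤ ρ w K) ∧ (∀ w, Tendsto (ρ w) atTop (𝓝 0))) :
    Missing.HasContinuumLimit S :=
  hasContinuumLimit_of_genFunCauchy S hβ hm h1 hl₀ (genFunCauchy_of_levelPieces_split S hl₀.le h)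

end Exit

/-! ## §7 Contrast: the conditional suppression (5b) is NOT implied by the aggregate one-run bound (3) -/

section Contrast

/-- **(5b) IS A GENUINELY CONDITIONAL ASK.**  For every `ε > 0`: finer labels `S = {0, 1, 2}` over two coarse labels
(`0, 1 ↦ 0`, `2 ↦ 1`), rough set `R = {1}`, weights `1, 1, 1∕ε` — the AGGREGATE rough fraction is `≤ ε` (input (3)'s
shape `Σ_R b ≤ ε·Σ_S b`) while the fibre over the coarse label `0` is exactly HALF ROUGH (conditional ratio 1): a light
fibre can hide an un-suppressed rough half behind a heavy smooth neighbour. [folklore] -/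
theorem condSuppression_not_of_aggregate (ε : ℝ) (hε : 0 < ε) :
    ∃ (S R : Finset (Fin 3)) (π : Fin 3 → Fin 2) (b : Fin 3 → ℝ),
      R ⊆ S ∧ (∀ s ∈ S, 0 ≤ b s) ∧ (∑ s ∈ R, b s ≤ ε * ∑ s ∈ S, b s) ∧
      0 < fiberSum (S \ R) π b 0 ∧ fiberSum R π b 0 = fiberSum (S \ R) π b 0 := by
  have hsd : (Finset.univ : Finset (Fin 3)) \ {1} = {0, 2} := by decide
  have hS : fiberSum ((Finset.univ : Finset (Fin 3)) \ {1}) (![0, 0, 1] : Fin 3 → Fin 2) ![1, 1, 1 / ε] (0 : Fin 2)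
      = 1 := by
    rw [hsd]
    unfold fiberSum
    rw [show (({0, 2} : Finset (Fin 3)).filter fun s => (![0, 0, 1] : Fin 3 → Fin 2) s = 0) = {0} by decide]
    simp
  have hR : fiberSum ({1} : Finset (Fin 3)) (![0, 0, 1] : Fin 3 → Fin 2) ![1, 1, 1 / ε] (0 : Fin 2) = 1 := by
    unfold fiberSum
    rw [show (({1} : Finset (Fin 3)).filter fun s => (![0, 0, 1] : Fin 3 → Fin 2) s = 0) = {1} by decide]
    simp
  refine ⟨Finset.univ, {1}, ![0, 0, 1], ![1, 1, 1 / ε], Finset.subset_univ _, fun s _ => ?_, ?_,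
    by rw [hS]; exact one_pos, by rw [hS, hR]⟩
  · fin_cases s <;> simp [hε.le]
  · rw [Finset.sum_singleton, Fin.sum_univ_three]
    simp only [Matrix.cons_val_one, Matrix.head_cons, Matrix.cons_val_zero, Matrix.cons_val_two, Matrix.tail_cons]
    rw [show ε * (1 + 1 + 1 / ε) = 2 * ε + 1 by field_simp; ring]
    linarith

end Contrast

end Summit.QuantumFields.BalabanUV.T4Continuum.NE7PairwiseFibreSplit

end
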